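import Summits.ABC.IUTFork.ForkGenuineWindowSharpLogDiff
import Literature.IUT.LogVolume.Theorem110RealStepII
import Literature.IUT.LogVolume.InitialThetaDataBadPlaceRamification
import Literature.IUT.LogVolume.GenuineSupportPrimesBound
import Literature.IUT.HodgeTheaters.InitialThetaDataOfModelPlaces
import HarnessLib

/-!
# The fork at [IUTchIII] Corollary 3.12 at a GENUINE datum of the `λ`-line: the LOWER bound
# `log(𝔡^K) ≥ log(𝔡^{F_tpd}) + (1 − 1/l)·log(𝔣^{F_tpd})` ([IUTchIV] Thm. 1.10 Step (ii), first display, p. 24;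
# [IUTchI] Def. 3.1 (c) / Ex. 3.2 (iv): `l ∣ e(w|v)` at the bad places) and the resulting slack of the (U)-line

Record-only PROOF file (D-0012) of the abc-iut cell (campaign-S seat abc-iut-S4, gen 6); TAKES NO SIDE. Sequel to this
seat's `ForkGenuineWindowSharpLogDiff` (p444393): there `Cor22.HullVolumeAtDatum P l δ ⟹ slotResidue(T) + ((ℓ⋇+3)/2 −
[F_mod:ℚ])·log(𝔡^K) ≤ δ` at every genuine datum `T`, `log(𝔡^K) = ndeg T.K (differentDivisor T.K)`. The tree holds the
UPPER bound of Step (ii) on `log(𝔡^K)` (`Cor22.ThetaVolumeDatumAt.ndeg_differentDivisor_le`); HERE the LOWER one: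

* `cond_above_le_cond_div_of_le_ramificationIdx` — for number fields `K ⊆ L`, a finite set `S` of primes of `K` and
  `m ≥ 1` with `e(w|v) ≥ m` for every `v ∈ S`, `w | v`: `(1/[L:ℚ])·Σ_{v∈S}Σ_{w|v} log N(w) ≤ (1/m)·(1/[K:ℚ])·Σ_{v∈S} log N(v)`
  (fundamental identity `Σ_w e_w f_w = [L:K]`; abc-iut-S-d2's `GenEll.cond_above_le_cond` is the case `m = 1`);
* `Cor22.logCondOver_le_div_of_le_ramificationIdx` — hence `log(𝔣^L) ≤ log(𝔣^{F_tpd})/m` for the `λ`-line's conductors;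
* **`Cor22.ThetaVolumeDatumAt.l_le_ramificationIdx_of_mem_badPlacesAvoid`** — at a genuine datum `T` of `(P, l)`: every
  place `w` of `K = T.K` over a pole `V` of `j(λ)` in `F_tpd` not dividing `2l` has `e(w|V) ≥ l` (the place of `F` under
  `w` is in `𝕍(F)^bad` by the (P5) choice — `x ∤ 2l`, and `E_F`, semistable with `j(E_F) = j(λ)`, is multiplicative at a
  pole of `j` —, so abc-iut-w5-d009's `ThetaData.l_le_ramificationIdx_of_under_mem_VFbad` applies, and `e(w|V) =
  e(x|V)·e(w|x)`);
* **`Cor22.ThetaVolumeDatumAt.ndeg_differentDivisor_ge`** — `log(𝔡^K) ≥ log-diff(λ) + (1 − 1/l)·log(𝔣^{F_tpd})`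
  (abc-iut-S-d2/S3's first display `Cor22.logDiff_add_logCondAvoid_le` + the previous item);
* **`PointDict.slotResidue_le_slack_of_hullVolumeAtDatum`** — for `[F_mod:ℚ] ≤ (ℓ⋇+3)/2`:
  `Cor22.HullVolumeAtDatum P l δ ⟹ slotResidue(T) ≤ δ − ((ℓ⋇+3)/2 − [F_mod:ℚ])·(log-diff(λ) + (1 − 1/l)·log 𝔣^{F_tpd})`
  at EVERY genuine datum `T` of `(P, l)`; (v2) `PointDict.pair_le_slack_of_hullVolumeAtDatum` — the same read at a pair of
  places over one support prime through abc-iut-S8's `PilotData.slotResidue_ge_pair_closed`.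

READING for VERDICT ¶7 (numbers, not a side). With `δ = B(P,l) = (l+1)/4·{(1+12d_mod/l)(log 𝔡^{F_tpd} + log 𝔣^{F_tpd}) +
2 log l + 52 + (20/3)·l*_mod·log 𝔰^≤}` and `(ℓ⋇+3)/2 = (l+5)/4`, the last item says that the UNION-LINE estimate
(`hvol` / `stub_hullRegimeAbove` of stmt-ABC-19678) asserts at every datum
`slotResidue(T) ≤ (log-diff + log-cond)·{(l+1)/4·(1+12d_mod/l) − ((l+5)/4 − d_mod)·(1 − 1/l)} + (l+1)/4·(2 log l + 52 +
(20/3)·l*_mod·log 𝔰^≤)` — the curly bracket is `≤ 4·d_mod + 3·d_mod/l + 2` (NOT of order `l`): on the (U) line the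
(Ind1) slot residue must be absorbed by O(d_mod) conductors plus print's Step (viii) constant. Against the residue's
lower bound at a split bad prime (abc-iut-S8 `PilotData.slotResidue_ge_pair_closed`: `Pr(v)Pr(w)·((ℓ⋇+1)(2ℓ⋇+1)/6)·μ(v) ≤
slotResidue`) this is a LOCAL-HEIGHT condition `μ(v) ≲ (24(4d_mod+2)/(l²·Pr(v)Pr(w)))·(log-diff + log-cond) +
(6/(l·Pr(v)Pr(w)))·(2 log l + 52 + (20/3)·l*_mod·log 𝔰^≤)`, i.e. at `l` large a lopsided split place whose local height
exceeds `≈ 5·10^7·d_mod/(Pr(v)Pr(w))` and a fraction `≈ 100·d_mod/l²` of the conductor violates `hvol` — no Szpiro-violating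
point is needed, only an admissible `(P, l)` with such a place (the (P2)/(P6) certification at one point remains the
obstruction to a kernel `¬`). Nothing here asserts `HullVolumeAtDatum` or the existence of data; no side taken on
[IUTchIII] Cor. 3.12 / [IUTchIV] Thm. 1.10; typed ≠ proved. PROOF-ONLY file: no definitions, no named `Prop` facts.
[cite: Mochizuki2012, IUTchIV Thm. 1.10 Step (ii) p. 24, Step (v) p. 27–29] [cite: Mochizuki2012, IUTchI Def. 3.1 (c) p. 62; Ex. 3.2 (iv) p. 71]
[cite: MochizukiGenEll2010, Prop. 1.7 (i) p. 9–10] [cite: NeukirchANT1999, Ch. I §8 Prop. (8.2)]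
-/

noncomputable section

open NumberField IsDedekindDomain Ideal Module

/-! ## 1. Conductors in a tower with ramification `≥ m` everywhere over `S` -/

namespace Literature.NumberTheory.DiophantineGeometry.GenEll

variable (K L : Type) [Field K] [NumberField K] [Field L] [NumberField L] [Algebra K L]

/-- **`(1/[L:ℚ])·Σ_{v∈S}Σ_{w|v} log N(w) ≤ (1/m)·(1/[K:ℚ])·Σ_{v∈S} log N(v)`** when every place of `L` over `S` has
ramification index `≥ m ≥ 1` over `K`: `m·Σ_{w|v} f_w ≤ Σ_w e_w f_w = [L:K]` (fundamental identity, Mathlib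
`Ideal.sum_ramification_inertia`) and `log N(w) = f_w·log N(v)`. The case `m = 1` is `cond_above_le_cond`.
[cite: MochizukiGenEll2010, Prop. 1.7 (i) p. 9–10] [cite: NeukirchANT1999, Ch. I §8 Prop. (8.2)] -/
theorem cond_above_le_cond_div_of_le_ramificationIdx (S : Finset (HeightOneSpectrum (𝓞 K))) {m : ℕ} (hm : 0 < m)
    (hram : ∀ v ∈ S, ∀ w ∈ IsDedekindDomain.primesOverFinset v.asIdeal (𝓞 L), m ≤ ramificationIdx' v.asIdeal w) :
    (finrank ℚ L : ℝ)⁻¹ * ∑ v ∈ S, ∑ w ∈ IsDedekindDomain.primesOverFinset v.asIdeal (𝓞 L),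
        Real.log (absNorm w : ℝ) ≤
      (m : ℝ)⁻¹ * ((finrank ℚ K : ℝ)⁻¹ * ∑ v ∈ S, Real.log (absNorm v.asIdeal : ℝ)) := by
  have hKpos : (0 : ℝ) < finrank ℚ K := by exact_mod_cast finrank_pos
  have hKL : (0 : ℝ) < finrank K L := by exact_mod_cast finrank_pos
  have hm0 : (0 : ℝ) < m := by exact_mod_cast hm
  have htower : (finrank ℚ L : ℝ) = finrank ℚ K * finrank K L := by
    exact_mod_cast (finrank_mul_finrank ℚ K L).symm
  -- per prime: `m·Σ_{w∣v} log N(w) ≤ [L:K]·log N(v)`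
  have hv : ∀ v ∈ S, (m : ℝ) * ∑ w ∈ IsDedekindDomain.primesOverFinset v.asIdeal (𝓞 L),
      Real.log (absNorm w : ℝ) ≤ (finrank K L : ℝ) * Real.log (absNorm v.asIdeal : ℝ) := by
    intro v hvS
    haveI := v.isMaximal
    have hcast : (finrank K L : ℝ) = ∑ w ∈ IsDedekindDomain.primesOverFinset v.asIdeal (𝓞 L),
        (ramificationIdx' v.asIdeal w : ℝ) * (inertiaDeg' v.asIdeal w : ℝ) := by
      rw [← Ideal.sum_ramification_inertia (R := 𝓞 K) (𝓞 L) K L v.ne_bot]; push_cast; rfl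
    have hlogv : 0 ≤ Real.log (absNorm v.asIdeal : ℝ) := by
      have h1 : (1 : ℝ) ≤ (absNorm v.asIdeal : ℕ) := by
        exact_mod_cast Nat.one_le_iff_ne_zero.mpr (by rw [Ne, Ideal.absNorm_eq_zero_iff]; exact v.ne_bot)
      exact Real.log_nonneg h1
    rw [hcast, Finset.mul_sum, Finset.sum_mul]
    refine Finset.sum_le_sum fun w hw => ?_
    rw [log_absNorm_eq_inertiaDeg_mul K L v.ne_bot hw, ← mul_assoc]
    refine mul_le_mul_of_nonneg_right ?_ hlogv
    have he : (m : ℝ) ≤ ramificationIdx' v.asIdeal w := by exact_mod_cast hram v hvS w hw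
    have hf : (0 : ℝ) ≤ inertiaDeg' v.asIdeal w := Nat.cast_nonneg _
    exact mul_le_mul_of_nonneg_right he hf
  have hsum : (m : ℝ) * ∑ v ∈ S, ∑ w ∈ IsDedekindDomain.primesOverFinset v.asIdeal (𝓞 L),
      Real.log (absNorm w : ℝ) ≤ (finrank K L : ℝ) * ∑ v ∈ S, Real.log (absNorm v.asIdeal : ℝ) := by
    rw [Finset.mul_sum, Finset.mul_sum]; exact Finset.sum_le_sum hv
  rw [htower, mul_inv]
  rw [show (m : ℝ)⁻¹ * ((finrank ℚ K : ℝ)⁻¹ * ∑ v ∈ S, Real.log (absNorm v.asIdeal : ℝ)) =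
      (finrank ℚ K : ℝ)⁻¹ * (finrank K L : ℝ)⁻¹ * ((m : ℝ)⁻¹ *
        ((finrank K L : ℝ) * ∑ v ∈ S, Real.log (absNorm v.asIdeal : ℝ))) by
    field_simp]
  refine mul_le_mul_of_nonneg_left ?_ (by positivity)
  rw [le_inv_mul_iff₀ hm0]
  exact hsum

end Literature.NumberTheory.DiophantineGeometry.GenEll

/-! ## 2. The `λ`-line's conductors: `log(𝔣^L) ≤ log(𝔣^{F_tpd})/m` -/

namespace Literature.IUT.LogVolume.Cor22

open Literature.NumberTheory.DiophantineGeometry.GenEll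

/-- **`log(𝔣^F) ≤ log(𝔣^{F_tpd})/m`** for the point `x_E = λ` presented over `F_tpd = P.F`, a finite set `S` of
rational primes, and an extension `F ⊇ F_tpd` every place of which over a bad-away-from-`S` place has ramification
index `≥ m` (`cond_above_le_cond_div_of_le_ramificationIdx`; the tree's `logCondOver_le_logCondAvoid` is `m = 1`).
[cite: Mochizuki2012, IUTchIV Thm. 1.10 Step (ii) p. 24] [claim: Mochizuki2012, status: disputed] -/
theorem logCondOver_le_div_of_le_ramificationIdx (P : NFPoint) (S : Finset ℕ) (F : Type) [Field F] [NumberField F]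
    [Algebra P.F F] {m : ℕ} (hm : 0 < m)
    (hram : ∀ v ∈ badPlacesAvoid P S, ∀ w ∈ IsDedekindDomain.primesOverFinset v.asIdeal (𝓞 F),
      m ≤ ramificationIdx' v.asIdeal w) :
    logCondOver P S F ≤ (m : ℝ)⁻¹ * logCondAvoid P S := by
  classical
  have h := cond_above_le_cond_div_of_le_ramificationIdx P.F F (badPlacesAvoid P S) hm hram
  rw [logCondAvoid_eq_sum]
  unfold logCondOver NFPoint.degree
  refine le_trans (le_of_eq ?_) h
  congr 1
  unfold badPlacesOver
  rw [Finset.sum_biUnion]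
  · refine Finset.sum_congr rfl fun v _ => ?_
    refine Finset.sum_preimage HeightOneSpectrum.asIdeal _ _
      (fun w : Ideal (𝓞 F) => Real.log (absNorm w : ℝ)) ?_
    intro w hw hnot
    exfalso
    rw [IsDedekindDomain.mem_primesOverFinset_iff v.ne_bot] at hw
    exact hnot ⟨⟨w, hw.1, Ideal.ne_bot_of_mem_primesOver v.ne_bot hw⟩, rfl⟩
  · intro v _ v' _ hne
    refine Finset.disjoint_left.mpr fun w hw hw' => hne ?_
    dsimp only at hw hw'
    rw [Finset.mem_preimage, IsDedekindDomain.mem_primesOverFinset_iff v.ne_bot] at hw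
    rw [Finset.mem_preimage, IsDedekindDomain.mem_primesOverFinset_iff v'.ne_bot] at hw'
    exact HeightOneSpectrum.ext (hw.2.over.trans hw'.2.over.symm)

/-! ## 3. At a genuine datum: `e(w|V) ≥ l` over every pole of `j(λ)` away from `2l` -/

namespace ThetaVolumeDatumAt

open Literature.IUT.HodgeTheaters

variable {P : NFPoint} {l : ℕ} (T : ThetaVolumeDatumAt P l)

/-- **Every place of the datum's `K` over a pole of `j(λ)` in `F_tpd` not dividing `2l` has ramification index `≥ l`
over `F_tpd`.** The place `x` of `F = T.F` under such a `w` does not divide `2l` and `E_F` — semistable ([IUTchI] Def.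
3.1 (b)), with `j(E_F) = j(λ)` a non-integer at `x` — is multiplicative there, so `x ∈ 𝕍(F)^bad` by the (P5) choice;
then `l ∣ e(w|x)` ([IUTchI] Def. 3.1 (c) + Ex. 3.2 (iv), abc-iut-w5-d009's `ThetaData.l_le_ramificationIdx_of_under_mem_VFbad`)
and `e(w|V) = e(x|V)·e(w|x)`. [cite: Mochizuki2012, IUTchI Def. 3.1 (b)(c) p. 61–62; Ex. 3.2 (iv) p. 71]
[cite: Mochizuki2012, IUTchIV Cor. 2.2 (ii) proof (P5) p. 46] [claim: Mochizuki2012, status: disputed] -/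
theorem l_le_ramificationIdx_of_mem_badPlacesAvoid :
    letI := T.instFieldF; letI := T.instNumberFieldF; letI := T.instAlgebraF; letI := T.instFieldK
    letI := T.instNumberFieldK; letI := T.instAlgebraK
    letI : Algebra P.F T.K := ((algebraMap T.F T.K).comp (algebraMap P.F T.F)).toAlgebra
    ∀ V ∈ badPlacesAvoid P {2, l}, ∀ w ∈ IsDedekindDomain.primesOverFinset V.asIdeal (𝓞 T.K),
      l ≤ ramificationIdx' V.asIdeal w := by
  classical
  letI := T.instFieldF; letI := T.instNumberFieldF; letI := T.instAlgebraF; letI := T.instFieldK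
  letI := T.instNumberFieldK; letI := T.instAlgebraK; letI := T.instFieldFbar; letI := T.instAlgebraFbar
  letI := T.instAlgebraKFbar; letI := T.instIsElliptic
  letI : Algebra P.F T.K := ((algebraMap T.F T.K).comp (algebraMap P.F T.F)).toAlgebra
  haveI : IsScalarTower P.F T.F T.K := IsScalarTower.of_algebraMap_eq fun _ => rfl
  intro V hV w hw
  obtain ⟨hwP, hwL⟩ := (IsDedekindDomain.mem_primesOverFinset_iff V.ne_bot (𝓞 T.K)).mp hw
  have hwbot : w ≠ ⊥ := Ideal.ne_bot_of_mem_primesOver V.ne_bot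
    ((IsDedekindDomain.mem_primesOverFinset_iff V.ne_bot (𝓞 T.K)).mp hw)
  set w' : HeightOneSpectrum (𝓞 T.K) := ⟨w, hwP, hwbot⟩ with hw'
  -- the place of `F` under `w`
  set x : HeightOneSpectrum (𝓞 T.F) := w'.under (𝓞 T.F) with hx
  haveI hwx : w.LiesOver x.asIdeal := ⟨rfl⟩
  haveI : x.asIdeal.LiesOver V.asIdeal := by
    constructor
    rw [hx, HeightOneSpectrum.under_asIdeal, Ideal.under_under]
    exact hwL.over
  -- `V` is the place of `F_tpd` under `x`, a pole of `j(λ)` away from `2l`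
  have hxV : finBelow P.F T.F x = V := by
    apply HeightOneSpectrum.ext
    show x.asIdeal.under (𝓞 P.F) = V.asIdeal
    exact (Ideal.LiesOver.over (p := V.asIdeal) (P := x.asIdeal)).symm
  have hVbad := hV
  unfold badPlacesAvoid at hVbad
  rw [Finset.mem_filter, mem_badPlaces_iff_ord_neg] at hVbad
  -- `x ∈ 𝕍(F)^bad` by the (P5) choice
  have hx2l : ∀ q ∈ ({2, l} : Finset ℕ), ((q : ℕ) : 𝓞 T.F) ∉ x.asIdeal := by
    intro q hq hmem
    apply hVbad.2 q hq
    rw [← hxV]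
    exact (natCast_mem_asIdeal_finBelow_iff (F := P.F) x q).mpr hmem
  have hordx : ord T.F x T.E.j < 0 := by
    rw [T.j_eq]
    exact (ord_algebraMap_neg_iff (F := P.F) x (jInv P.x)).mpr (hxV ▸ hVbad.1)
  have hmult : T.E.HasMultiplicativeReductionAt x :=
    hasMultiplicativeReductionAt_of_ord_j_neg T.E T.D.isSemistable hordx
  have hxbad : FinitePlace.mk x ∈ T.D.VFbad := by
    refine (T.isP5Choice (FinitePlace.mk x)).mpr ?_
    rw [FinitePlace.maximalIdeal_mk]
    exact ⟨hx2l, hmult⟩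
  -- `l ≤ e(w|x)` and `e(w|V) = e(x|V)·e(w|x)`
  have hl : l ≤ ramificationIdx' x.asIdeal w := by
    have h := ThetaData.l_le_ramificationIdx_of_under_mem_VFbad T.D (w := w') (by rw [← hx]; exact hxbad)
    rw [← hx] at h
    exact h
  have htower : ramificationIdx' V.asIdeal w = ramificationIdx' V.asIdeal x.asIdeal * ramificationIdx' x.asIdeal w :=
    Ideal.ramificationIdx'_algebra_tower' V.asIdeal x.asIdeal w
  have hxpos : 1 ≤ ramificationIdx' V.asIdeal x.asIdeal :=
    Nat.one_le_iff_ne_zero.mpr (Ideal.IsDedekindDomain.ramificationIdx'_ne_zero_of_liesOver x.asIdeal V.ne_bot)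
  rw [htower]
  calc l = 1 * l := (one_mul l).symm
    _ ≤ ramificationIdx' V.asIdeal x.asIdeal * ramificationIdx' x.asIdeal w := Nat.mul_le_mul hxpos hl

/-- **THE LOWER BOUND OF STEP (ii) AT A DATUM**: `log(𝔡^K) ≥ log-diff(λ) + (1 − 1/l)·log(𝔣^{F_tpd})` for the field
`K = F(E_F[l])` of every genuine Θ-volume datum at `(P, l)` — print's first display
"`log(𝔡^{F_tpd}) + log(𝔣^{F_tpd}) ≤ log(𝔡^F) + log(𝔣^F)`" read for `F_tpd ⊆ K` (the tree's `Cor22.logDiff_add_logCondAvoid_le`)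
together with `log(𝔣^K) ≤ log(𝔣^{F_tpd})/l` (`l_le_ramificationIdx_of_mem_badPlacesAvoid`).
[cite: Mochizuki2012, IUTchIV Thm. 1.10 Step (ii) p. 24] [claim: Mochizuki2012, status: disputed] -/
theorem ndeg_differentDivisor_ge (hl : 0 < l) :
    (letI := T.instFieldK; letI := T.instNumberFieldK
     P.logDiff + (1 - 1 / (l : ℝ)) * logCondAvoid P {2, l} ≤ ndeg T.K (differentDivisor T.K)) := by
  letI := T.instFieldF; letI := T.instNumberFieldF; letI := T.instAlgebraF; letI := T.instFieldK
  letI := T.instNumberFieldK; letI := T.instAlgebraK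
  letI : Algebra P.F T.K := ((algebraMap T.F T.K).comp (algebraMap P.F T.F)).toAlgebra
  have h1 := logDiff_add_logCondAvoid_le P {2, l} T.K
  have h2 := logCondOver_le_div_of_le_ramificationIdx P {2, l} T.K hl (T.l_le_ramificationIdx_of_mem_badPlacesAvoid)
  have h3 : (extend P T.K).logDiff = ndeg T.K (differentDivisor T.K) := logDiff_eq_ndeg_differentDivisor (extend P T.K)
  rw [h3] at h1
  have h4 : (l : ℝ)⁻¹ * logCondAvoid P {2, l} = 1 / (l : ℝ) * logCondAvoid P {2, l} := by rw [one_div]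
  rw [h4] at h2
  nlinarith [h1, h2]

end ThetaVolumeDatumAt

end Literature.IUT.LogVolume.Cor22

/-! ## 4. The slack of the (U)-line at a datum -/

namespace Summit.ABC.IUTFork.PointDict

open Literature.IUT.LogVolume Literature.NumberTheory.DiophantineGeometry.GenEll

variable {P : NFPoint} {l : ℕ}

/-- **`Cor22.HullVolumeAtDatum P l δ` forces
`slotResidue(T) ≤ δ − ((ℓ⋇+3)/2 − [F_mod:ℚ])·(log-diff(λ) + (1 − 1/l)·log 𝔣^{F_tpd})`
at EVERY genuine datum `T` of `(P, l)` with `[F_mod:ℚ] ≤ (ℓ⋇+3)/2`** (this seat's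
`slotResidue_add_mul_ndeg_le_of_hullVolumeAtDatum` + `Cor22.ThetaVolumeDatumAt.ndeg_differentDivisor_ge`). With
`δ = B(P,l)` (the `hvol` binder; the `stub_hullRegimeAbove` conclusion of stmt-ABC-19678's skeleton; `(ℓ⋇+3)/2 = (l+5)/4`)
the slack left to the (Ind1) slot residue is `(log-diff + log-cond)·{(l+1)/4·(1+12d_mod/l) − ((l+5)/4 − d_mod)(1 − 1/l)}
+ (l+1)/4·(2 log l + 52 + (20/3)·l*_mod·log 𝔰^≤)`, whose coefficient is `≤ 4·d_mod + 3·d_mod/l + 2`. Nothing asserted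
about the existence of data; no side taken. [claim: Mochizuki2012, status: disputed]
[cite: Mochizuki2012, IUTchIV Thm. 1.10 Steps (ii), (v) p. 24, 27–29] -/
theorem slotResidue_le_slack_of_hullVolumeAtDatum {δ : ℝ} (h : Cor22.HullVolumeAtDatum P l δ) (hl : 0 < l)
    (T : Cor22.ThetaVolumeDatumAt P l)
    (hd : (letI := T.instFieldF; letI := T.instNumberFieldF; letI := T.instFieldK; letI := T.instNumberFieldK
      letI := T.instAlgebraK; letI := T.instIsElliptic
      (Module.finrank ℚ (Literature.IUT.HodgeTheaters.fieldOfModuli T.E) : ℝ) ≤ ((T.I.X.lstar : ℝ) + 3) / 2)) :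
    (letI := T.instFieldF; letI := T.instNumberFieldF; letI := T.instFieldK; letI := T.instNumberFieldK
     letI := T.instAlgebraK; letI := T.instIsElliptic
     T.I.X.slotResidue T.I.supportPrimes ≤
       δ - (((T.I.X.lstar : ℝ) + 3) / 2 - Module.finrank ℚ (Literature.IUT.HodgeTheaters.fieldOfModuli T.E)) *
         (P.logDiff + (1 - 1 / (l : ℝ)) * Cor22.logCondAvoid P {2, l})) := by
  letI := T.instFieldF; letI := T.instNumberFieldF; letI := T.instFieldK; letI := T.instNumberFieldK
  letI := T.instAlgebraK; letI := T.instIsElliptic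
  have h1 := slotResidue_add_mul_ndeg_le_of_hullVolumeAtDatum h T
  have h2 := T.ndeg_differentDivisor_ge hl
  have hc : 0 ≤ ((T.I.X.lstar : ℝ) + 3) / 2 -
      Module.finrank ℚ (Literature.IUT.HodgeTheaters.fieldOfModuli T.E) := by linarith
  have h3 := mul_le_mul_of_nonneg_left h2 hc
  change T.I.X.slotResidue T.I.supportPrimes +
      (((T.I.X.lstar : ℝ) + 3) / 2 - Module.finrank ℚ (Literature.IUT.HodgeTheaters.fieldOfModuli T.E)) *
        ndeg T.K (differentDivisor T.K) ≤ δ at h1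
  change T.I.X.slotResidue T.I.supportPrimes ≤ _
  linarith


/-- **The union-line hull estimate at a PAIR OF PLACES over one prime, against the SLACK** (v2 append; composition with
abc-iut-S8's closed-form lower bound `PilotData.slotResidue_ge_pair_closed`:
`Pr(v)·Pr(w)·((ℓ⋇+1)(2ℓ⋇+1)/6)·(μ(v) − μ(w)) ≤ slotResidue`, `μ(u) = P_q(u)·ln N(u)/n_u`): `Cor22.HullVolumeAtDatum P l δ`
forces, at every genuine datum `T` of `(P, l)` with `d_mod ≤ (ℓ⋇+3)/2`, every support prime `p` and places `v, w` of `F_mod`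
over `p`: `Pr(v)·Pr(w)·((ℓ⋇+1)(2ℓ⋇+1)/6)·(μ(v) − μ(w)) ≤ δ − ((ℓ⋇+3)/2 − d_mod)·(log-diff(λ) + (1 − 1/l)·log 𝔣^{F_tpd})`. With
`δ = B(P,l)` and `(ℓ⋇+1)(2ℓ⋇+1)/6 ≈ l²/12`, at a prime split into a deep bad `v` and a good `w` (`μ(w) = 0`) this reads
`μ(v) ≲ (12(4d_mod+2)/(l²·Pr(v)Pr(w)))·(log-diff + log-cond) + (3(l+1)/(l²·Pr(v)Pr(w)))·(2 log l + 52 + (20/3)·l*_mod·log 𝔰^≤)`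
— compare abc-iut-S7's `ordPair_le_of_hullVolumeAtDatum` (the full `δ` on the right, leading coefficient
`6(1+12d_mod/l)/(Pr·Pr)` on the conductor): the coefficient is now `≈ 12(4d_mod+2)/(l²·Pr·Pr) → 0` in `l`. Nothing asserted
about the existence of data; no side taken. [cite: Mochizuki2012, IUTchIV Thm. 1.10 Step (v) p. 27–29]
[cite: DupuyHilado2025, §3.3, §3.6, §4.7, §4.12] [claim: Mochizuki2012, status: disputed] -/
theorem pair_le_slack_of_hullVolumeAtDatum {δ : ℝ} (h : Cor22.HullVolumeAtDatum P l δ) (hl : 0 < l)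
    (T : Cor22.ThetaVolumeDatumAt P l)
    (hd : (letI := T.instFieldF; letI := T.instNumberFieldF; letI := T.instFieldK; letI := T.instNumberFieldK
      letI := T.instAlgebraK; letI := T.instIsElliptic
      (Module.finrank ℚ (Literature.IUT.HodgeTheaters.fieldOfModuli T.E) : ℝ) ≤ ((T.I.X.lstar : ℝ) + 3) / 2)) :
    (letI := T.instFieldF; letI := T.instNumberFieldF; letI := T.instFieldK; letI := T.instNumberFieldK
     letI := T.instAlgebraK; letI := T.instIsElliptic
     ∀ (p : ℕ) [Fact p.Prime], p ∈ T.I.supportPrimes →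
       ∀ v w : placesOver (Literature.IUT.HodgeTheaters.fieldOfModuli T.E) p,
         weight (Literature.IUT.HodgeTheaters.fieldOfModuli T.E) v.1 *
             weight (Literature.IUT.HodgeTheaters.fieldOfModuli T.E) w.1 *
             ((((T.I.X.lstar : ℝ) + 1) * (2 * T.I.X.lstar + 1)) / 6) *
           (T.I.X.qPilot v.1 * logNorm (Literature.IUT.HodgeTheaters.fieldOfModuli T.E) v.1 /
               (localDegree (Literature.IUT.HodgeTheaters.fieldOfModuli T.E) v.1 : ℝ)
             - T.I.X.qPilot w.1 * logNorm (Literature.IUT.HodgeTheaters.fieldOfModuli T.E) w.1 /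
               (localDegree (Literature.IUT.HodgeTheaters.fieldOfModuli T.E) w.1 : ℝ)) ≤
         δ - (((T.I.X.lstar : ℝ) + 3) / 2 - Module.finrank ℚ (Literature.IUT.HodgeTheaters.fieldOfModuli T.E)) *
           (P.logDiff + (1 - 1 / (l : ℝ)) * Cor22.logCondAvoid P {2, l})) := by
  letI := T.instFieldF; letI := T.instNumberFieldF; letI := T.instFieldK; letI := T.instNumberFieldK
  letI := T.instAlgebraK; letI := T.instIsElliptic
  intro p _ hp v w
  have h1 := slotResidue_le_slack_of_hullVolumeAtDatum h hl T hd
  have h2 := T.I.X.slotResidue_ge_pair_closed T.I.supportPrimes hp v w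
  exact h2.trans h1

end Summit.ABC.IUTFork.PointDict

end
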